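import Mathlib.MeasureTheory.Measure.Haar.Unique
import Literature.MathematicalPhysics.KineticTheory.HardSphereEulerLLN
import Literature.Analysis.FluidPDE.HardSpherePhaseSpaceProofs

/-!
# Macroscopic bookkeeping for the hydrodynamic-limit assembly — I: block fields versus empirical fields

Helper file for item stmt-AtomisticToContinuum-11094 (`StiffCollisionalRelaxation.Assembly`, the
macroscopic bookkeeping shared with `CollisionIsometryCLT.MacroClosure`). Elementary,
restatement-independent pieces that every version of the assembly consumes in its last step
("L¹-closeness of the block fields gives `TendstoHydroFieldsAt`") and in the identification of the
Euler data with the law-of-large-numbers profile: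

* `integral_empiricalMeasure'` — the empirical average of a vector-valued observable;
* `integral_mul_blockDensity` (+ momentum / energy twins): pairing the block field
  `x ↦ ⟨μ_z, φ(· - x) g⟩` with a test function `χ` is the empirical average of the mollified test
  function `(∫ χ(x) φ(q - x) dx) · g(v)` (Fubini over the finite empirical sum);
* `abs_densityField_sub_le` (+ twins): the empirical field tested against `χ` and the block field
  tested against `χ` differ by at most the `r`-modulus `η` of `χ` (times `∫ ‖v‖ dμ_z`,
  `∫ ‖v‖²/2 dμ_z`), `r` the kernel radius — the commutator estimate;
* `continuous_blockDensity` (+ twins), `integral_blockDensity/Momentum/Energy` — block fields are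
  continuous in the block centre; their space integrals are the total mass `1`, the mean velocity
  and the kinetic energy of the empirical measure;
* `eq_of_tendsto_measure_lt_norm_sub` — limits in probability under probability laws are unique;
* `eq_of_forall_integral_mul_eq` — continuous functions on `𝕋³` with equal pairings against all
  continuous test functions are equal.
-/

namespace Summit.AtomisticToContinuum.HydrodynamicLimit.Theorems.MacroBookkeeping

open MeasureTheory Filter Topology Finset
open Literature.Probability.LatticeModels Literature.MathematicalPhysics.StatisticalMechanics
open Literature.MathematicalPhysics.KineticTheory
open Literature.Analysis.FluidPDE (Config empiricalMeasure integral_empiricalMeasure)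
open Literature.Analysis.FluidPDE.Torus (euclidDist)
open scoped ENNReal

noncomputable section

variable {N : ℕ}

/-! ### Two kernel facts on `𝕋³` (Haar invariance; mollification is close to the identity)

(Proved independently of the sibling helper `Theorems/CollisionIsometryCLTMesoscopicLLNKernels.lean`
so that this file only depends on Literature.) -/

/-- A continuous function on `𝕋³` is integrable. -/
theorem integrable_T3' {F : Type*} [NormedAddCommGroup F] {g : T3 → F} (hg : Continuous g) :
    Integrable g := integrable_of_continuous_T3 hg

/-- `∫ φ(y - x) dx = ∫ φ` (the Haar probability measure of `𝕋³` is negation invariant). -/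
theorem integral_kernel_comp_sub_left (φ : T3 → ℝ) (y : T3) : ∫ x, φ (y - x) = ∫ x, φ x := by
  haveI : (volume : Measure T3).IsNegInvariant :=
    Measure.IsAddHaarMeasure.isNegInvariant_of_regular (volume : Measure T3)
  exact integral_sub_left_eq_self φ volume y

/-- **Mollification is close to the identity**: for a continuous kernel `φ ≥ 0` of mass `1`
supported in the minimal-image ball of radius `r`, and `f` with `|f y - f x| ≤ η` whenever
`euclidDist y x < r`, `|∫ f(x) φ(y - x) dx - f(y)| ≤ η` for every `y`. -/
theorem abs_integral_mul_kernel_sub_le {φ : T3 → ℝ} {r : ℝ} (hφc : Continuous φ)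
    (hφ0 : ∀ y, 0 ≤ φ y) (hφ1 : ∫ y, φ y = 1) (hsupp : ∀ y, r ≤ euclidDist y 0 → φ y = 0)
    {f : T3 → ℝ} (hf : Continuous f) {η : ℝ} (hmod : ∀ x y, euclidDist y x < r → |f y - f x| ≤ η)
    (y : T3) : |(∫ x, f x * φ (y - x)) - f y| ≤ η := by
  have hφy : Continuous fun x => φ (y - x) := hφc.comp (continuous_const.sub continuous_id)
  have h1 : ∫ x, φ (y - x) = 1 := by rw [integral_kernel_comp_sub_left φ y, hφ1]
  have hi1 : Integrable (fun x => f x * φ (y - x)) := integrable_T3' (hf.mul hφy)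
  have hi2 : Integrable (fun x => f y * φ (y - x)) := integrable_T3' (continuous_const.mul hφy)
  have hrepr : (∫ x, f x * φ (y - x)) - f y = ∫ x, (f x - f y) * φ (y - x) := by
    have hfy : f y = ∫ x, f y * φ (y - x) := by rw [integral_const_mul, h1, mul_one]
    conv_lhs => rw [hfy]
    rw [← integral_sub hi1 hi2]
    exact integral_congr_ae (ae_of_all _ fun x => by ring)
  rw [hrepr]
  have hi3 : Integrable (fun x => (f x - f y) * φ (y - x)) :=
    integrable_T3' ((hf.sub continuous_const).mul hφy)
  have hi4 : Integrable (fun x => η * φ (y - x)) := integrable_T3' (continuous_const.mul hφy)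
  calc |∫ x, (f x - f y) * φ (y - x)| ≤ ∫ x, |(f x - f y) * φ (y - x)| :=
        abs_integral_le_integral_abs
    _ ≤ ∫ x, η * φ (y - x) := by
        refine integral_mono hi3.abs hi4 fun x => ?_
        dsimp only
        rw [abs_mul, abs_of_nonneg (hφ0 _)]
        by_cases hyx : euclidDist y x < r
        · have hxy : euclidDist x y < r := by
            rwa [Literature.Analysis.FluidPDE.Torus.euclidDist_comm]
          exact mul_le_mul_of_nonneg_right (hmod y x hxy) (hφ0 _)
        · have h0 : φ (y - x) = 0 := hsupp _ (by
            rw [Literature.Analysis.FluidPDE.Torus.euclidDist_eq, sub_zero,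
              ← Literature.Analysis.FluidPDE.Torus.euclidDist_eq]
            exact le_of_not_gt hyx)
          rw [h0, mul_zero, mul_zero]
    _ = η := by rw [integral_const_mul, h1, mul_one]

/-! ### Empirical averages of vector-valued observables -/

/-- `∫ f dμ_z = N⁻¹ ∑ᵢ f(zᵢ)` for a vector-valued observable (the tree's
`integral_empiricalMeasure` is the real-valued case). For `N = 0` both sides vanish. -/
theorem integral_empiricalMeasure' {F : Type*} [NormedAddCommGroup F] [NormedSpace ℝ F]
    [CompleteSpace F] (z : Config N (Fin 3) T3) (f : T3 × V3 → F) :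
    ∫ y, f y ∂empiricalMeasure z = (N : ℝ)⁻¹ • ∑ i, f (z i) := by
  rw [Literature.Analysis.FluidPDE.empiricalMeasure_eq, integral_smul_measure,
    integral_finsetSum_measure fun i _ => integrable_dirac (by simp)]
  simp [integral_dirac, ENNReal.toReal_inv]

/-! ### Block fields paired with test functions -/

section Pairing

variable (z : Config N (Fin 3) T3) {χ φ : T3 → ℝ}

/-- **Fubini for the block density.** `∫ χ(x) ρ̄_z(x) dx = ⟨μ_z, ∫ χ(x) φ(q - x) dx⟩`. -/
theorem integral_mul_blockDensity (hχ : Continuous χ) (hφ : Continuous φ) :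
    ∫ x, χ x * empiricalDensityField z (fun y => φ (y - x)) =
      ∫ y, (∫ x, χ x * φ (y.1 - x)) ∂empiricalMeasure z := by
  simp only [empiricalDensityField, integral_empiricalMeasure, Finset.mul_sum]
  rw [integral_finsetSum _ fun i _ => integrable_T3' (by fun_prop)]
  refine Finset.sum_congr rfl fun i _ => ?_
  rw [← integral_const_mul]
  exact integral_congr_ae (ae_of_all _ fun x => by ring)

/-- **Fubini for the block momentum.** `∫ χ(x) m̄_z(x) dx = ⟨μ_z, (∫ χ(x) φ(q - x) dx) v⟩`. -/
theorem integral_smul_blockMomentum (hχ : Continuous χ) (hφ : Continuous φ) :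
    ∫ x, χ x • empiricalMomentumField z (fun y => φ (y - x)) =
      ∫ y, (∫ x, χ x * φ (y.1 - x)) • y.2 ∂empiricalMeasure z := by
  simp only [empiricalMomentumField, integral_empiricalMeasure', Finset.smul_sum, smul_smul]
  rw [integral_finsetSum _ fun i _ => (integrable_T3' (by fun_prop)).smul_const _]
  refine Finset.sum_congr rfl fun i _ => ?_
  rw [integral_smul_const, ← integral_const_mul]
  congr 1
  exact integral_congr_ae (ae_of_all _ fun x => by ring)

/-- **Fubini for the block energy.** `∫ χ(x) Ē_z(x) dx = ⟨μ_z, (∫ χ(x) φ(q - x) dx) |v|²/2⟩`. -/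
theorem integral_mul_blockEnergy (hχ : Continuous χ) (hφ : Continuous φ) :
    ∫ x, χ x * empiricalEnergyField z (fun y => φ (y - x)) =
      ∫ y, (∫ x, χ x * φ (y.1 - x)) * (‖y.2‖ ^ 2 / 2) ∂empiricalMeasure z := by
  simp only [empiricalEnergyField, integral_empiricalMeasure, Finset.mul_sum]
  rw [integral_finsetSum _ fun i _ => integrable_T3' (by fun_prop)]
  refine Finset.sum_congr rfl fun i _ => ?_
  rw [← integral_mul_const, ← integral_const_mul]
  exact integral_congr_ae (ae_of_all _ fun x => by ring)

end Pairing

/-! ### The commutator estimate -/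

section Commutator

variable {φ χ : T3 → ℝ} {r η : ℝ}

/-- **Density commutator.** If `χ` varies by at most `η` on minimal-image balls of radius `r` and
`φ ≥ 0` is a continuous kernel of mass one supported in the ball of radius `r`, then the empirical
density field tested against `χ` and the block density paired with `χ` differ by at most `η`
(for `N ≥ 1` particles). -/
theorem abs_densityField_sub_le (hN : N ≠ 0) (z : Config N (Fin 3) T3) (hφc : Continuous φ)
    (hφ0 : ∀ y, 0 ≤ φ y) (hφ1 : ∫ y, φ y = 1) (hsupp : ∀ y, r ≤ euclidDist y 0 → φ y = 0)
    (hχ : Continuous χ) (hmod : ∀ x y, euclidDist y x < r → |χ y - χ x| ≤ η) :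
    |empiricalDensityField z χ - ∫ x, χ x * empiricalDensityField z (fun y => φ (y - x))| ≤ η := by
  have hN' : (0 : ℝ) < N := by exact_mod_cast Nat.pos_of_ne_zero hN
  have key : empiricalDensityField z χ - ∫ x, χ x * empiricalDensityField z (fun y => φ (y - x)) =
      (N : ℝ)⁻¹ * ∑ i, (χ (z i).1 - ∫ x, χ x * φ ((z i).1 - x)) := by
    rw [integral_mul_blockDensity z hχ hφc]
    simp only [empiricalDensityField, integral_empiricalMeasure]
    rw [← mul_sub, Finset.sum_sub_distrib]
  rw [key, abs_mul, abs_of_nonneg (by positivity)]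
  calc (N : ℝ)⁻¹ * |∑ i, (χ (z i).1 - ∫ x, χ x * φ ((z i).1 - x))|
      ≤ (N : ℝ)⁻¹ * ∑ _i : Fin N, η := by
        refine mul_le_mul_of_nonneg_left ((Finset.abs_sum_le_sum_abs _ _).trans
          (Finset.sum_le_sum fun i _ => ?_)) (by positivity)
        rw [abs_sub_comm]
        exact abs_integral_mul_kernel_sub_le hφc hφ0 hφ1 hsupp hχ hmod (z i).1
    _ = η := by
        rw [Finset.sum_const, Finset.card_univ, Fintype.card_fin, nsmul_eq_mul, ← mul_assoc,
          inv_mul_cancel₀ hN'.ne', one_mul]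

/-- **Momentum commutator.** Same, for the momentum field: the error is at most
`η · ⟨μ_z, ‖v‖⟩`. -/
theorem norm_momentumField_sub_le (z : Config N (Fin 3) T3) (hφc : Continuous φ)
    (hφ0 : ∀ y, 0 ≤ φ y) (hφ1 : ∫ y, φ y = 1) (hsupp : ∀ y, r ≤ euclidDist y 0 → φ y = 0)
    (hχ : Continuous χ) (hmod : ∀ x y, euclidDist y x < r → |χ y - χ x| ≤ η) :
    ‖empiricalMomentumField z χ - ∫ x, χ x • empiricalMomentumField z (fun y => φ (y - x))‖ ≤
      η * ∫ y, ‖y.2‖ ∂empiricalMeasure z := by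
  have key : empiricalMomentumField z χ - ∫ x, χ x • empiricalMomentumField z (fun y => φ (y - x)) =
      (N : ℝ)⁻¹ • ∑ i, (χ (z i).1 - ∫ x, χ x * φ ((z i).1 - x)) • (z i).2 := by
    rw [integral_smul_blockMomentum z hχ hφc]
    simp only [empiricalMomentumField, integral_empiricalMeasure', sub_smul, Finset.sum_sub_distrib,
      smul_sub]
  rw [key, norm_smul, Real.norm_eq_abs, abs_of_nonneg (by positivity)]
  simp only [integral_empiricalMeasure]
  rw [mul_left_comm, Finset.mul_sum]
  refine mul_le_mul_of_nonneg_left ((norm_sum_le _ _).trans (Finset.sum_le_sum fun i _ => ?_))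
    (by positivity)
  rw [norm_smul, Real.norm_eq_abs, abs_sub_comm]
  exact mul_le_mul_of_nonneg_right
    (abs_integral_mul_kernel_sub_le hφc hφ0 hφ1 hsupp hχ hmod (z i).1) (norm_nonneg _)

/-- **Energy commutator.** Same, for the energy field: the error is at most
`η · ⟨μ_z, ‖v‖²/2⟩`. -/
theorem abs_energyField_sub_le (z : Config N (Fin 3) T3) (hφc : Continuous φ)
    (hφ0 : ∀ y, 0 ≤ φ y) (hφ1 : ∫ y, φ y = 1) (hsupp : ∀ y, r ≤ euclidDist y 0 → φ y = 0)
    (hχ : Continuous χ) (hmod : ∀ x y, euclidDist y x < r → |χ y - χ x| ≤ η) :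
    |empiricalEnergyField z χ - ∫ x, χ x * empiricalEnergyField z (fun y => φ (y - x))| ≤
      η * ∫ y, ‖y.2‖ ^ 2 / 2 ∂empiricalMeasure z := by
  have key : empiricalEnergyField z χ - ∫ x, χ x * empiricalEnergyField z (fun y => φ (y - x)) =
      (N : ℝ)⁻¹ * ∑ i, (χ (z i).1 - ∫ x, χ x * φ ((z i).1 - x)) * (‖(z i).2‖ ^ 2 / 2) := by
    rw [integral_mul_blockEnergy z hχ hφc]
    simp only [empiricalEnergyField, integral_empiricalMeasure, sub_mul, Finset.sum_sub_distrib,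
      mul_sub]
  rw [key, abs_mul, abs_of_nonneg (by positivity : (0 : ℝ) ≤ (N : ℝ)⁻¹)]
  simp only [integral_empiricalMeasure]
  rw [mul_left_comm, Finset.mul_sum]
  refine mul_le_mul_of_nonneg_left ((Finset.abs_sum_le_sum_abs _ _).trans
    (Finset.sum_le_sum fun i _ => ?_)) (by positivity)
  rw [abs_mul, abs_sub_comm, abs_of_nonneg (by positivity : (0 : ℝ) ≤ ‖(z i).2‖ ^ 2 / 2)]
  exact mul_le_mul_of_nonneg_right
    (abs_integral_mul_kernel_sub_le hφc hφ0 hφ1 hsupp hχ hmod (z i).1) (by positivity)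

end Commutator

/-! ### Regularity and totals of the block fields -/

section Blocks

variable (z : Config N (Fin 3) T3) {φ : T3 → ℝ}

/-- The block density `x ↦ ρ̄_z(x)` is continuous. -/
theorem continuous_blockDensity (hφ : Continuous φ) :
    Continuous fun x => empiricalDensityField z (fun y => φ (y - x)) := by
  simp only [empiricalDensityField, integral_empiricalMeasure]
  fun_prop

/-- The block momentum `x ↦ m̄_z(x)` is continuous. -/
theorem continuous_blockMomentum (hφ : Continuous φ) :
    Continuous fun x => empiricalMomentumField z (fun y => φ (y - x)) := by
  simp only [empiricalMomentumField, integral_empiricalMeasure']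
  fun_prop

/-- The block energy `x ↦ Ē_z(x)` is continuous. -/
theorem continuous_blockEnergy (hφ : Continuous φ) :
    Continuous fun x => empiricalEnergyField z (fun y => φ (y - x)) := by
  simp only [empiricalEnergyField, integral_empiricalMeasure]
  fun_prop

/-- **Total block mass**: `∫ ρ̄_z(x) dx = 1` for a kernel of mass one and `N ≥ 1` particles. -/
theorem integral_blockDensity (hN : N ≠ 0) (hφ : Continuous φ) (hφ1 : ∫ y, φ y = 1) :
    ∫ x, empiricalDensityField z (fun y => φ (y - x)) = 1 := by
  have h := integral_mul_blockDensity z continuous_const hφ (χ := fun _ => (1 : ℝ))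
  simp only [one_mul] at h
  rw [h, integral_empiricalMeasure]
  simp only [integral_kernel_comp_sub_left, hφ1, Finset.sum_const, Finset.card_univ,
    Fintype.card_fin, nsmul_eq_mul, mul_one]
  exact inv_mul_cancel₀ (by exact_mod_cast hN)

/-- **Total block momentum**: `∫ m̄_z(x) dx = ⟨μ_z, v⟩`. -/
theorem integral_blockMomentum (hφ : Continuous φ) (hφ1 : ∫ y, φ y = 1) :
    ∫ x, empiricalMomentumField z (fun y => φ (y - x)) = ∫ y, y.2 ∂empiricalMeasure z := by
  have h := integral_smul_blockMomentum z continuous_const hφ (χ := fun _ => (1 : ℝ))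
  simp only [one_smul, one_mul] at h
  rw [h]
  refine integral_congr_ae (ae_of_all _ fun y => ?_)
  simp only [integral_kernel_comp_sub_left, hφ1, one_smul]

/-- **Total block energy = kinetic energy**: `∫ Ē_z(x) dx = ⟨μ_z, ‖v‖²/2⟩`. -/
theorem integral_blockEnergy (hφ : Continuous φ) (hφ1 : ∫ y, φ y = 1) :
    ∫ x, empiricalEnergyField z (fun y => φ (y - x)) =
      ∫ y, ‖y.2‖ ^ 2 / 2 ∂empiricalMeasure z := by
  have h := integral_mul_blockEnergy z continuous_const hφ (χ := fun _ => (1 : ℝ))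
  simp only [one_mul] at h
  rw [h]
  refine integral_congr_ae (ae_of_all _ fun y => ?_)
  simp only [integral_kernel_comp_sub_left, hφ1, one_mul]

end Blocks

/-! ### Uniqueness of limits in probability; identification of continuous profiles -/

/-- **Limits in probability are unique** (probability laws): if the laws of `X_N` concentrate at
`a` and at `b`, then `a = b`. -/
theorem eq_of_tendsto_measure_lt_norm_sub {F : Type*} [NormedAddCommGroup F] {Ω : ℕ → Type*}
    [∀ N, MeasurableSpace (Ω N)] (P : (N : ℕ) → Measure (Ω N)) [∀ N, IsProbabilityMeasure (P N)]
    (X : (N : ℕ) → Ω N → F) {a b : F}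
    (ha : ∀ δ : ℝ, 0 < δ → Tendsto (fun N => P N {ω | δ < ‖X N ω - a‖}) atTop (𝓝 0))
    (hb : ∀ δ : ℝ, 0 < δ → Tendsto (fun N => P N {ω | δ < ‖X N ω - b‖}) atTop (𝓝 0)) :
    a = b := by
  by_contra hab
  have hd : 0 < ‖a - b‖ / 3 := div_pos (norm_pos_iff.2 (sub_ne_zero.2 hab)) three_pos
  have hcover : ∀ N, (Set.univ : Set (Ω N)) ⊆
      {ω | ‖a - b‖ / 3 < ‖X N ω - a‖} ∪ {ω | ‖a - b‖ / 3 < ‖X N ω - b‖} := by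
    intro N ω _
    by_contra hω
    simp only [Set.mem_union, Set.mem_setOf_eq, not_or, not_lt] at hω
    have h := norm_sub_le_norm_sub_add_norm_sub a (X N ω) b
    rw [norm_sub_rev a (X N ω)] at h
    linarith [norm_nonneg (a - b)]
  have hle : ∀ N, (1 : ℝ≥0∞) ≤ P N {ω | ‖a - b‖ / 3 < ‖X N ω - a‖} +
      P N {ω | ‖a - b‖ / 3 < ‖X N ω - b‖} := fun N =>
    calc (1 : ℝ≥0∞) = P N Set.univ := measure_univ.symm
      _ ≤ P N ({ω | ‖a - b‖ / 3 < ‖X N ω - a‖} ∪ {ω | ‖a - b‖ / 3 < ‖X N ω - b‖}) :=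
          measure_mono (hcover N)
      _ ≤ _ := measure_union_le _ _
  have hlim : Tendsto (fun N => P N {ω | ‖a - b‖ / 3 < ‖X N ω - a‖} +
      P N {ω | ‖a - b‖ / 3 < ‖X N ω - b‖}) atTop (𝓝 0) := by
    simpa using (ha _ hd).add (hb _ hd)
  have h01 : (1 : ℝ≥0∞) ≤ 0 := ge_of_tendsto' hlim hle
  exact one_ne_zero (le_zero_iff.1 h01)

/-- **Identification of continuous profiles.** Two continuous functions on `𝕋³` with the same
pairings against every continuous test function are equal. -/
theorem eq_of_forall_integral_mul_eq {f g : T3 → ℝ} (hf : Continuous f) (hg : Continuous g)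
    (h : ∀ χ : T3 → ℝ, Continuous χ → ∫ x, χ x * f x = ∫ x, χ x * g x) : f = g := by
  have hfg : Continuous fun x => f x - g x := hf.sub hg
  have hint : ∫ x, (f x - g x) * (f x - g x) = 0 := by
    have h1 := h _ hfg
    have hi1 : Integrable fun x => (f x - g x) * f x := integrable_T3' (hfg.mul hf)
    have hi2 : Integrable fun x => (f x - g x) * g x := integrable_T3' (hfg.mul hg)
    calc ∫ x, (f x - g x) * (f x - g x) = ∫ x, ((f x - g x) * f x - (f x - g x) * g x) :=
          integral_congr_ae (ae_of_all _ fun x => by ring)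
      _ = 0 := by rw [integral_sub hi1 hi2, h1, sub_self]
  have hae : (fun x => (f x - g x) * (f x - g x)) =ᵐ[volume] (fun _ => (0 : ℝ)) :=
    (integral_eq_zero_iff_of_nonneg (fun x => mul_self_nonneg _)
      (integrable_T3' (hfg.mul hfg))).1 hint
  have heq : (fun x => (f x - g x) * (f x - g x)) = fun _ => (0 : ℝ) :=
    Measure.eq_of_ae_eq hae (hfg.mul hfg) continuous_const
  funext x
  have hx := congrFun heq x
  exact sub_eq_zero.1 (mul_self_eq_zero.1 hx)

/-- Vector-valued version: continuous `V3`-valued functions with the same pairings against every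
continuous scalar test function are equal. -/
theorem eq_of_forall_integral_smul_eq {f g : T3 → V3} (hf : Continuous f) (hg : Continuous g)
    (h : ∀ χ : T3 → ℝ, Continuous χ → ∫ x, χ x • f x = ∫ x, χ x • g x) : f = g := by
  have hj : ∀ j : Fin 3, (fun y => f y j) = fun y => g y j := fun j => by
    refine eq_of_forall_integral_mul_eq ((EuclideanSpace.proj j).continuous.comp hf)
      ((EuclideanSpace.proj j).continuous.comp hg) fun χ hχ => ?_
    have h1 := congrArg (fun w : V3 => w j) (h χ hχ)
    have e1 : (∫ x, χ x • f x) j = ∫ x, χ x * f x j := by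
      have hi : Integrable (fun x => χ x • f x) := integrable_T3' (hχ.smul hf)
      simpa using ((EuclideanSpace.proj j : V3 →L[ℝ] ℝ).integral_comp_comm hi).symm
    have e2 : (∫ x, χ x • g x) j = ∫ x, χ x * g x j := by
      have hi : Integrable (fun x => χ x • g x) := integrable_T3' (hχ.smul hg)
      simpa using ((EuclideanSpace.proj j : V3 →L[ℝ] ℝ).integral_comp_comm hi).symm
    simpa only [e1, e2] using h1
  funext x
  ext j
  exact congrFun (hj j) x

end

end Summit.AtomisticToContinuum.HydrodynamicLimit.Theorems.MacroBookkeeping
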